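import Summits.BirchSwinnertonDyer.Rank1Residual.WAll.AltClosersX1ShaWitness
import Summits.BirchSwinnertonDyer.Rank1Residual.WAll.AltClosersResidualCellsWild
import Summits.BirchSwinnertonDyer.Rank1Residual.WAll.TargetAdditiveAtThreeWildTwinSlices
import Summits.BirchSwinnertonDyer.Rank1Residual.WAll.TargetAdditiveFiveLeSharpSlices
import HarnessLib

/-!
# Rung W-ALL (D-0120): THE REGISTRY AT THE FINEST LOADED GRANULARITY — one hypothesis per registered
# leaf / live route target / typed residual, and W-ALL from them by name (cell `bsd-wall`, lane 2,
# seat ty-2 g5; glue, Theses-free)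

HONEST FRAMING (cell `bsd-wall`, run/shared/lean/pub/bsd-wall/; WALL-BRIEF-v1 §2). NOTHING ASSERTED:
no `def`, no `@[conjecture]`, no named fact, no route file imported; W-ALL is OPEN; every
hypothesis below is an OPEN leaf, a registered rung leaf, a typed target, or a PUBLISHED named fact.
This file composes the landed registries (`wAllExclusions_of_sliceLeaves_x1Slices`, p509093) with the
slice glue ty-1 g6 typed along the two newest lane-3 habitats — `TargetAdditiveAtThreeWildTwinSlices`
(p514681: the wild rank-one leaf = TWIN cell `WAllExclAddWildRankOneSurjTwin` ∧ item 20388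
`WAllExclAddWildRankOneOffSurjTwin`) and `TargetAdditiveFiveLeSharpSlices` (p515653: row 2 @≥5 rank
one = ♯ `WAllExclAdditiveFiveLeRankOneSharp` (the conclusion of route `AdditiveKolyvaginRoad`'s kernel)
∧ off-♯ `WAllExclAdditiveFiveLeRankOneOffSharp` (= its residual item 20134)) — so that EVERY live
lane-3 route and every registered rung leaf is ONE named hypothesis of ONE theorem:

| hyp | statement (ns `Summit.BirchSwinnertonDyer` unless dotted) | who closes it (route / rung / item) |
|---|---|---|
| `h5` | `…BirchSwinnertonDyer.Rank1Residual.NonCMAtTwo` | rung K4 (ByReductionTypeAtTwo / TwoAdicConverse); route `ThetaPartnerAtTwo` (closes-target) |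
| `hM3`, `hG3` | `WAllExclAddPotMultAtThree`, `WAllExclAddPotOrdAtThree` | K1 `AdditiveBranchIMC` lower half + OPEN upper halves at `3` (`AltClosersGlueAtThreeCells` §1) |
| `hT3` | `WAllExclAddTameSSAtThree` | K8 `QuadraticBranchSignedControl` + K9-tame (`wAllExclAddTameSSAtThree_of_sharpLeaves`) |
| `hW0` | `WAllExclAddWildRankZero` | K9-wild / W2 `KimAtThreeKolyvagin` (item 20387 of `UniversalToricDescent` by name) |
| `hWT` | `WAllExclAddWildRankOneSurjTwin` | route `UniversalToricDescent` (attacked cell) |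
| `hWO` | `WAllExclAddWildRankOneOffSurjTwin` | item 20388 (K9-wild: `wildRankOneOffCellAtThree_of_o6Sharp`; atoms Red / IrrNotSurj / twinless) |
| `h50` | `WAllExclAdditiveFiveLeRankZero` | item 20133 `RankZeroAdditive` (K1 + print on the covered locus, `AltClosersAdditiveCells` §3) |
| `h5S` | `WAllExclAdditiveFiveLeRankOneSharp` | route `AdditiveKolyvaginRoad` (kernel conclusion) |
| `h5O` | `WAllExclAdditiveFiveLeRankOneOffSharp` | item 20134 `OffSharpRankOneAdditive` |
| `hK2a`, `hK2b` | `X11b.MultiplicativeRankOne`, `…AtThree` | rungs K2a / K2b (KolyvaginRoadThree, ClassRecordThree, ErratumRoadFive) |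
| `hX1B` | `WAllCornerX1RankZeroBalanced` | KIT-booked / any balanced-class route (RTE retired); or §3 (Ш-witness) |
| `hX1U` | `WAllCornerX1RankZeroUnbalanced` | line `shawitness` (`AltClosersX1ShaWitness`); K5 `EisensteinPrimes` |
| `hX1R1` | `X1.RankOne.Statement` | K5 (type A = KY Theorem A road + LEAF I1 `TypeBRankOneUnridered`) |
| `hX2` | `X2.Target` | K5 `EisensteinPrimes` (X2 conjunct) |
| `hK3` | `Supersingular.SignedSupersingular` | rung K3 (rows 6 / 8) |
| `h73`, `h75` | `WAllCornerX7AtThree`, `WAllCornerX7FiveLe` | item 20251 (K3 + Wuthrich); route `SignedBaseChange` (closes-target) |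
| `hK6`, `hX10b`, `hX11a` | `BSDpOnClassX9`, `X10.BSDpOnClassX10b`, `X11a.Target` | K6 `SmallImageMuTransfer`; X10 kernels; K2 family |
| `hF3`, `hF5` | `WAllCornerFInertBadAtThree`, `WAllCornerFInertBadFiveLe` | item 19225 + LLT; route `BiquadraticEisensteinDescent` |
| `hF2`, `hFr` | `WAllCornerFTwo`, `WAllCornerFRamified` | K7t `SylvesterTwoHeegnerIndex` ⊂ OPEN; K7r `RamifiedSevenEllipticUnits` ⊂ OPEN |

* §1 the new slices FROM THE RUNG LEAVES by name (K9-wild closes the three wild rank-one slices;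
  O7.LowerHalf + the rank-1 upper half + K8 + K9t close ♯ and off-♯);
* §2 `wAllExclusions_of_finestLeaves`, `wAll_of_finestLeaves_primaryGZ` (26 leaf/target hyps + `hW`
  + FIFTEEN named facts), `wAllFormula_of_finestLeaves_primaryGZ` (+ `hL0`);
* §3 the same with row 4 rank `0` in Ш-WITNESS currency (`AltClosersX1ShaWitness`):
  `wAllExclusions_of_finestLeaves_x1ShaWitness`, `wAll_of_finestLeaves_x1ShaWitness_primaryGZ`.

No census number moves; typed ≠ proved ≠ endorsed; BSD is not proved by any of this.

References: `WAll/AltClosersGlueX1Slices.lean` (p509093), `WAll/AltClosersResidualCellsWild.lean` (p515515),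
`WAll/AltClosersX1ShaWitness.lean` (p513686), `WAll/TargetAdditiveAtThreeWildTwinSlices.lean` (p514681),
`WAll/TargetAdditiveFiveLeSharpSlices.lean` (p515653); [cite: Miller2011LMS, §1 and Def. 1.1];
[cite: Darmon2004, Thm. 3.22 and §3.9].
-/

noncomputable section

open scoped Classical

open WeierstrassCurve Literature.NumberTheory.EllipticCurves
  Literature.NumberTheory.EllipticCurves.Rank1Residual
  Literature.NumberTheory.EllipticCurves.Rank1Residual.Typed
  Literature.NumberTheory.EllipticCurves.Wuthrich2014
  Literature.NumberTheory.EllipticCurves.ModularForms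

set_option autoImplicit false

namespace Summit.BirchSwinnertonDyer.Rank1Residual.WAll

open Summit.BirchSwinnertonDyer
open Summit.BirchSwinnertonDyer.BirchSwinnertonDyer.Rank1Residual (NonCMAtTwo BSDpOnClassX9)

/-! ## §1 The newest slices from the rung leaves by name -/

/-- **The three wild rank-one slices (twin cell · off the twin cell · twinless) ⇐ LEAF K9-wild
`Additive.O6Sharp` + GZK** (`wAllExclAddWildRanks_of_o6Sharp` then `twinSlices_of_wAllExclAddWildRankOne`).
[folklore] -/
theorem wildTwinSlices_of_o6Sharp (hK9w : Additive.O6Sharp)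
    (hGZK : rank_eq_analyticRank_of_analyticRank_le_one) :
    WAllExclAddWildRankOneSurjTwin ∧ WAllExclAddWildRankOneOffSurjTwin ∧
      WAllExclAddWildRankOneSurjTwinless :=
  twinSlices_of_wAllExclAddWildRankOne (wAllExclAddWildRanks_of_o6Sharp hK9w hGZK).2

/-- **Item 20388's named leaf `WAllExclAddWildRankOneOffSurjTwin` is `AltClosersResidualCellsWild`'s
inline residual shape** (`rfl`), so its three closers there apply verbatim; e.g. from K9-wild.
[folklore] -/
theorem wAllExclAddWildRankOneOffSurjTwin_of_o6Sharp (hK9w : Additive.O6Sharp)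
    (hGZK : rank_eq_analyticRank_of_analyticRank_le_one) : WAllExclAddWildRankOneOffSurjTwin :=
  wildRankOneOffCellAtThree_of_o6Sharp hK9w hGZK

/-- **♯ and off-♯ at `p ≥ 5`, rank one ⇐ `Additive.O7.LowerHalf` (rank-1 half of K1) + the rank-1
upper half on `N10.Locus` (OPEN) + K8 + K9t + GZK** (`wAllExclAdditiveFiveLeRankOne_of_leaves` then
`sharpSlices_of_wAllExclAdditiveFiveLeRankOne`). [folklore] -/
theorem sharpSlices_of_leaves (hO7 : Additive.O7.LowerHalf)
    (hUp1 : ∀ (W : WeierstrassCurve ℚ) [W.IsElliptic] [W.IsGloballyMinimal] (p : ℕ) [Fact p.Prime],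
      W.analyticRank = 1 → 5 ≤ p → Additive.N10.Locus W p → MissingUpperBoundAt W p)
    (hK8 : Additive.O5SharpGss) (hK9t : Additive.O5SharpTprime)
    (hGZK : rank_eq_analyticRank_of_analyticRank_le_one) :
    WAllExclAdditiveFiveLeRankOneSharp ∧ WAllExclAdditiveFiveLeRankOneOffSharp :=
  sharpSlices_of_wAllExclAdditiveFiveLeRankOne
    (wAllExclAdditiveFiveLeRankOne_of_leaves hO7 hUp1 hK8 hK9t hGZK)

/-- **Row 2's four prime × rank slices from the finest cells** — bookkeeping used by §2:
@3 rank `0` / rank `1` from (M)@3, (G-ord)@3, O5@3, wild r0, wild r1 twin + off-twin; @≥5 rank `1`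
from ♯ + off-♯. [folklore] -/
theorem primeRankSlices_of_finestCells (hM3 : WAllExclAddPotMultAtThree)
    (hG3 : WAllExclAddPotOrdAtThree) (hT3 : WAllExclAddTameSSAtThree) (hW0 : WAllExclAddWildRankZero)
    (hWT : WAllExclAddWildRankOneSurjTwin) (hWO : WAllExclAddWildRankOneOffSurjTwin)
    (h5S : WAllExclAdditiveFiveLeRankOneSharp) (h5O : WAllExclAdditiveFiveLeRankOneOffSharp) :
    WAllExclAdditiveAtThreeRankZero ∧ WAllExclAdditiveAtThreeRankOne ∧ WAllExclAdditiveFiveLeRankOne := by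
  obtain ⟨h30, h31⟩ := wAllExclAdditiveAtThree_iff_ranks.mp
    (wAllExclAdditiveAtThree_iff_cellsAtThree.mpr ⟨hM3, hG3, hT3,
      wAllExclAddWild_iff_ranks.mpr ⟨hW0, wAllExclAddWildRankOne_of_surjTwin_of_offSurjTwin hWT hWO⟩⟩)
  exact ⟨h30, h31, wAllExclAdditiveFiveLeRankOne_of_sharp_of_offSharp h5S h5O⟩

/-! ## §2 The registry at the finest loaded granularity -/

/-- **THE CLOSED LIST, one hypothesis per registered leaf / live route target / typed residual** (table
in the module docstring): rows 1–12 of W-ALL from 26 leaf/target hypotheses + `hW` + `hmod` + `hGZK`.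
[folklore] -/
theorem wAllExclusions_of_finestLeaves (h5 : NonCMAtTwo)
    (hM3 : WAllExclAddPotMultAtThree) (hG3 : WAllExclAddPotOrdAtThree)
    (hT3 : WAllExclAddTameSSAtThree) (hW0 : WAllExclAddWildRankZero)
    (hWT : WAllExclAddWildRankOneSurjTwin) (hWO : WAllExclAddWildRankOneOffSurjTwin)
    (h50 : WAllExclAdditiveFiveLeRankZero)
    (h5S : WAllExclAdditiveFiveLeRankOneSharp) (h5O : WAllExclAdditiveFiveLeRankOneOffSharp)
    (hK2a : X11b.MultiplicativeRankOne) (hK2b : X11b.MultiplicativeRankOneAtThree)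
    (hX1B : WAllCornerX1RankZeroBalanced) (hX1U : WAllCornerX1RankZeroUnbalanced)
    (hX1R1 : X1.RankOne.Statement) (hX2 : X2.Target)
    (hK3 : Supersingular.SignedSupersingular)
    (h73 : WAllCornerX7AtThree) (h75 : WAllCornerX7FiveLe)
    (hK6 : BSDpOnClassX9) (hX10b : X10.BSDpOnClassX10b) (hX11a : X11a.Target)
    (hF3 : WAllCornerFInertBadAtThree) (hF5 : WAllCornerFInertBadFiveLe)
    (hF2 : WAllCornerFTwo) (hFr : WAllCornerFRamified)
    (hW : sha_dvd_analyticSha) (hmod : hasEntireLFunction_rat)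
    (hGZK : rank_eq_analyticRank_of_analyticRank_le_one) : WAllExclusions := by
  obtain ⟨h30, h31, h51⟩ := primeRankSlices_of_finestCells hM3 hG3 hT3 hW0 hWT hWO h5S h5O
  exact wAllExclusions_of_sliceLeaves_x1Slices h5 h30 h31 h50 h51 hK2a hK2b hX1B hX1U hX1R1 hX2 hK3 h73
    h75 hK6 hX10b hX11a hF3 hF5 hF2 hFr hW hmod hGZK

/-- **W-ALL — `BSD(E,p)` for every prime `p` and every `E/ℚ` of analytic rank `≤ 1` — from the finest
leaves + FIFTEEN named facts, the Gross–Zagier side primary** (`wAll_of_exclusions_primaryGZ ∘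
wAllExclusions_of_finestLeaves`; `hmod` derived from `hmodP`, `hGZK` fed from its road of record).
[cite: Darmon2004, Thm. 3.22 and §3.9] -/
theorem wAll_of_finestLeaves_primaryGZ (h5 : NonCMAtTwo)
    (hM3 : WAllExclAddPotMultAtThree) (hG3 : WAllExclAddPotOrdAtThree)
    (hT3 : WAllExclAddTameSSAtThree) (hW0 : WAllExclAddWildRankZero)
    (hWT : WAllExclAddWildRankOneSurjTwin) (hWO : WAllExclAddWildRankOneOffSurjTwin)
    (h50 : WAllExclAdditiveFiveLeRankZero)
    (h5S : WAllExclAdditiveFiveLeRankOneSharp) (h5O : WAllExclAdditiveFiveLeRankOneOffSharp)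
    (hK2a : X11b.MultiplicativeRankOne) (hK2b : X11b.MultiplicativeRankOneAtThree)
    (hX1B : WAllCornerX1RankZeroBalanced) (hX1U : WAllCornerX1RankZeroUnbalanced)
    (hX1R1 : X1.RankOne.Statement) (hX2 : X2.Target)
    (hK3 : Supersingular.SignedSupersingular)
    (h73 : WAllCornerX7AtThree) (h75 : WAllCornerX7FiveLe)
    (hK6 : BSDpOnClassX9) (hX10b : X10.BSDpOnClassX10b) (hX11a : X11a.Target)
    (hF3 : WAllCornerFInertBadAtThree) (hF5 : WAllCornerFInertBadFiveLe)
    (hF2 : WAllCornerFTwo) (hFr : WAllCornerFRamified)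
    (hW : sha_dvd_analyticSha)
    (hSk : Skinner2016.thmC_padicValRat_bsd_rank_zero)
    (hBCS : BurungaleCastellaSkinner2025.cor131_padicValRat_bsd_rank_le_one)
    (hJSW : JetchevSkinnerWan2017.thm121_padicValRat_bsd_rank_one)
    (hCGS : CastellaGrossiSkinner2025.thmD_padicValRat_bsd_rank_le_one)
    (hGV : GreenbergVatsal2000.thm13_charIdeal_eq_of_gvPar) (hGr : greenberg_charValue_rankZero)
    (hmodP : nonempty_modularParametrizationData)
    (hWa : waldspurger_exists_heegnerField_twist_ne_zero)
    (hMM : murtyMurty_exists_heegnerField_twist_simpleZero)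
    (hGZ : ∀ (N : ℕ) [NeZero N] (W : WeierstrassCurve ℚ) (K : Type) [Field K] [NumberField K],
      gross_zagier N W K)
    (hKo : ∀ (N : ℕ) [NeZero N] (W : WeierstrassCurve ℚ) (K : Type) [Field K] [NumberField K],
      kolyvagin N W K)
    (hCM : bsdTriple_of_hasCM_of_L_one_ne_zero) (hKob : Kobayashi2013.cor14_bsdp_of_cm_rank_one)
    (hYZ : YanZhu2026.thm415_padicValRat_bsd_rank_le_one)
    (hLLT : LiLiuTian2024.thm11_bsdp_of_cm_rank_one) : WAll := by
  obtain ⟨h30, h31, h51⟩ := primeRankSlices_of_finestCells hM3 hG3 hT3 hW0 hWT hWO h5S h5O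
  exact wAll_of_sliceLeaves_x1Slices_primaryGZ h5 h30 h31 h50 h51 hK2a hK2b hX1B hX1U hX1R1 hX2 hK3 h73
    h75 hK6 hX10b hX11a hF3 hF5 hF2 hFr hW hSk hBCS hJSW hCGS hGV hGr hmodP hWa hMM hGZ hKo hCM hKob hYZ
    hLLT

/-- **THE FULL BSD FORMULA FOR EVERY `E/ℚ` OF ANALYTIC RANK `≤ 1`** from the finest leaves:
FIFTEEN named facts and ONE sign binder `hL0`.
[cite: GrossZagier1986, Thm. V.(2.1) (p. 311) and V.§2 (pp. 312–313)]
[cite: Darmon2004, Thm. 3.22 and §3.9] -/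
theorem wAllFormula_of_finestLeaves_primaryGZ (h5 : NonCMAtTwo)
    (hM3 : WAllExclAddPotMultAtThree) (hG3 : WAllExclAddPotOrdAtThree)
    (hT3 : WAllExclAddTameSSAtThree) (hW0 : WAllExclAddWildRankZero)
    (hWT : WAllExclAddWildRankOneSurjTwin) (hWO : WAllExclAddWildRankOneOffSurjTwin)
    (h50 : WAllExclAdditiveFiveLeRankZero)
    (h5S : WAllExclAdditiveFiveLeRankOneSharp) (h5O : WAllExclAdditiveFiveLeRankOneOffSharp)
    (hK2a : X11b.MultiplicativeRankOne) (hK2b : X11b.MultiplicativeRankOneAtThree)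
    (hX1B : WAllCornerX1RankZeroBalanced) (hX1U : WAllCornerX1RankZeroUnbalanced)
    (hX1R1 : X1.RankOne.Statement) (hX2 : X2.Target)
    (hK3 : Supersingular.SignedSupersingular)
    (h73 : WAllCornerX7AtThree) (h75 : WAllCornerX7FiveLe)
    (hK6 : BSDpOnClassX9) (hX10b : X10.BSDpOnClassX10b) (hX11a : X11a.Target)
    (hF3 : WAllCornerFInertBadAtThree) (hF5 : WAllCornerFInertBadFiveLe)
    (hF2 : WAllCornerFTwo) (hFr : WAllCornerFRamified)
    (hW : sha_dvd_analyticSha)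
    (hSk : Skinner2016.thmC_padicValRat_bsd_rank_zero)
    (hBCS : BurungaleCastellaSkinner2025.cor131_padicValRat_bsd_rank_le_one)
    (hJSW : JetchevSkinnerWan2017.thm121_padicValRat_bsd_rank_one)
    (hCGS : CastellaGrossiSkinner2025.thmD_padicValRat_bsd_rank_le_one)
    (hGV : GreenbergVatsal2000.thm13_charIdeal_eq_of_gvPar) (hGr : greenberg_charValue_rankZero)
    (hmodP : nonempty_modularParametrizationData)
    (hWa : waldspurger_exists_heegnerField_twist_ne_zero)
    (hMM : murtyMurty_exists_heegnerField_twist_simpleZero)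
    (hGZ : ∀ (N : ℕ) [NeZero N] (W : WeierstrassCurve ℚ) (K : Type) [Field K] [NumberField K],
      gross_zagier N W K)
    (hKo : ∀ (N : ℕ) [NeZero N] (W : WeierstrassCurve ℚ) (K : Type) [Field K] [NumberField K],
      kolyvagin N W K)
    (hCM : bsdTriple_of_hasCM_of_L_one_ne_zero) (hKob : Kobayashi2013.cor14_bsdp_of_cm_rank_one)
    (hYZ : YanZhu2026.thm415_padicValRat_bsd_rank_le_one)
    (hLLT : LiLiuTian2024.thm11_bsdp_of_cm_rank_one)
    (hL0 : re_entireLFunction_one_nonneg) : WAllFormula :=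
  wAllFormula_of_wAll_oneSign hmodP hL0 hWa hGZ
    (wAll_of_finestLeaves_primaryGZ h5 hM3 hG3 hT3 hW0 hWT hWO h50 h5S h5O hK2a hK2b hX1B hX1U hX1R1 hX2
      hK3 h73 h75 hK6 hX10b hX11a hF3 hF5 hF2 hFr hW hSk hBCS hJSW hCGS hGV hGr hmodP hWa hMM hGZ hKo hCM
      hKob hYZ hLLT)

/-! ## §3 The same with row 4 rank `0` in Ш-witness currency -/

/-- **THE CLOSED LIST from the finest leaves, row 4 rank `0` by the MIN-DIGIT and WITNESS cells**
(`x1RankZeroSlices_of_minDigit_of_witness`: PUB⁵ + `hmin` + `hwit` replace the two rank-`0` X1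
slices; `hW`, `hmod`, `hGZK` are already inputs). [cite: Wuthrich2014, Prop. 21 (p. 400)] -/
theorem wAllExclusions_of_finestLeaves_x1ShaWitness (h5 : NonCMAtTwo)
    (hM3 : WAllExclAddPotMultAtThree) (hG3 : WAllExclAddPotOrdAtThree)
    (hT3 : WAllExclAddTameSSAtThree) (hW0 : WAllExclAddWildRankZero)
    (hWT : WAllExclAddWildRankOneSurjTwin) (hWO : WAllExclAddWildRankOneOffSurjTwin)
    (h50 : WAllExclAdditiveFiveLeRankZero)
    (h5S : WAllExclAdditiveFiveLeRankOneSharp) (h5O : WAllExclAdditiveFiveLeRankOneOffSharp)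
    (hK2a : X11b.MultiplicativeRankOne) (hK2b : X11b.MultiplicativeRankOneAtThree)
    (hCT : exists_casselsTate_pairing (K := ℚ)) (hCassels : bsdRHS_eq_of_isIsogenous)
    (hmin : ∀ (W : WeierstrassCurve ℚ) [W.IsElliptic] [W.IsGloballyMinimal] (p : ℕ)
      [Fact p.Prime], ClassX1 W p → W.analyticRank = 0 →
      ∃ (W' : WeierstrassCurve ℚ) (_ : W'.IsElliptic) (_ : W'.IsGloballyMinimal), IsIsogenous W W' ∧
        ∃ q : ℚ, shaAn W' = (q : ℂ) ∧ 0 ≤ padicValRat p q ∧ padicValRat p q ≤ 2)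
    (hwit : ∀ (W W' : WeierstrassCurve ℚ) [W.IsElliptic] [W.IsGloballyMinimal]
      [W'.IsElliptic] [W'.IsGloballyMinimal] (p : ℕ) [Fact p.Prime], ClassX1 W p → W.analyticRank = 0 →
      IsIsogenous W W' → ∀ q : ℚ, shaAn W' = (q : ℂ) → 0 < padicValRat p q → padicValRat p q ≤ 2 →
      ∃ x : W'.sha, x ≠ 0 ∧ p • x = 0)
    (hX1R1 : X1.RankOne.Statement) (hX2 : X2.Target)
    (hK3 : Supersingular.SignedSupersingular)
    (h73 : WAllCornerX7AtThree) (h75 : WAllCornerX7FiveLe)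
    (hK6 : BSDpOnClassX9) (hX10b : X10.BSDpOnClassX10b) (hX11a : X11a.Target)
    (hF3 : WAllCornerFInertBadAtThree) (hF5 : WAllCornerFInertBadFiveLe)
    (hF2 : WAllCornerFTwo) (hFr : WAllCornerFRamified)
    (hW : sha_dvd_analyticSha) (hmod : hasEntireLFunction_rat)
    (hGZK : rank_eq_analyticRank_of_analyticRank_le_one) : WAllExclusions := by
  obtain ⟨hB, hU⟩ := x1RankZeroSlices_of_minDigit_of_witness hCT hW hGZK hmod hCassels hmin hwit
  exact wAllExclusions_of_finestLeaves h5 hM3 hG3 hT3 hW0 hWT hWO h50 h5S h5O hK2a hK2b hB hU hX1R1 hX2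
    hK3 h73 h75 hK6 hX10b hX11a hF3 hF5 hF2 hFr hW hmod hGZK

/-- **W-ALL from the finest leaves with row 4 rank `0` in Ш-witness currency, SEVENTEEN named facts.**
[cite: Darmon2004, Thm. 3.22 and §3.9] [cite: Wuthrich2014, Prop. 21 (p. 400)] -/
theorem wAll_of_finestLeaves_x1ShaWitness_primaryGZ (h5 : NonCMAtTwo)
    (hM3 : WAllExclAddPotMultAtThree) (hG3 : WAllExclAddPotOrdAtThree)
    (hT3 : WAllExclAddTameSSAtThree) (hW0 : WAllExclAddWildRankZero)
    (hWT : WAllExclAddWildRankOneSurjTwin) (hWO : WAllExclAddWildRankOneOffSurjTwin)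
    (h50 : WAllExclAdditiveFiveLeRankZero)
    (h5S : WAllExclAdditiveFiveLeRankOneSharp) (h5O : WAllExclAdditiveFiveLeRankOneOffSharp)
    (hK2a : X11b.MultiplicativeRankOne) (hK2b : X11b.MultiplicativeRankOneAtThree)
    (hCT : exists_casselsTate_pairing (K := ℚ)) (hCassels : bsdRHS_eq_of_isIsogenous)
    (hmin : ∀ (W : WeierstrassCurve ℚ) [W.IsElliptic] [W.IsGloballyMinimal] (p : ℕ)
      [Fact p.Prime], ClassX1 W p → W.analyticRank = 0 →
      ∃ (W' : WeierstrassCurve ℚ) (_ : W'.IsElliptic) (_ : W'.IsGloballyMinimal), IsIsogenous W W' ∧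
        ∃ q : ℚ, shaAn W' = (q : ℂ) ∧ 0 ≤ padicValRat p q ∧ padicValRat p q ≤ 2)
    (hwit : ∀ (W W' : WeierstrassCurve ℚ) [W.IsElliptic] [W.IsGloballyMinimal]
      [W'.IsElliptic] [W'.IsGloballyMinimal] (p : ℕ) [Fact p.Prime], ClassX1 W p → W.analyticRank = 0 →
      IsIsogenous W W' → ∀ q : ℚ, shaAn W' = (q : ℂ) → 0 < padicValRat p q → padicValRat p q ≤ 2 →
      ∃ x : W'.sha, x ≠ 0 ∧ p • x = 0)
    (hX1R1 : X1.RankOne.Statement) (hX2 : X2.Target)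
    (hK3 : Supersingular.SignedSupersingular)
    (h73 : WAllCornerX7AtThree) (h75 : WAllCornerX7FiveLe)
    (hK6 : BSDpOnClassX9) (hX10b : X10.BSDpOnClassX10b) (hX11a : X11a.Target)
    (hF3 : WAllCornerFInertBadAtThree) (hF5 : WAllCornerFInertBadFiveLe)
    (hF2 : WAllCornerFTwo) (hFr : WAllCornerFRamified)
    (hW : sha_dvd_analyticSha)
    (hSk : Skinner2016.thmC_padicValRat_bsd_rank_zero)
    (hBCS : BurungaleCastellaSkinner2025.cor131_padicValRat_bsd_rank_le_one)
    (hJSW : JetchevSkinnerWan2017.thm121_padicValRat_bsd_rank_one)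
    (hCGS : CastellaGrossiSkinner2025.thmD_padicValRat_bsd_rank_le_one)
    (hGV : GreenbergVatsal2000.thm13_charIdeal_eq_of_gvPar) (hGr : greenberg_charValue_rankZero)
    (hmodP : nonempty_modularParametrizationData)
    (hWa : waldspurger_exists_heegnerField_twist_ne_zero)
    (hMM : murtyMurty_exists_heegnerField_twist_simpleZero)
    (hGZ : ∀ (N : ℕ) [NeZero N] (W : WeierstrassCurve ℚ) (K : Type) [Field K] [NumberField K],
      gross_zagier N W K)
    (hKo : ∀ (N : ℕ) [NeZero N] (W : WeierstrassCurve ℚ) (K : Type) [Field K] [NumberField K],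
      kolyvagin N W K)
    (hCM : bsdTriple_of_hasCM_of_L_one_ne_zero) (hKob : Kobayashi2013.cor14_bsdp_of_cm_rank_one)
    (hYZ : YanZhu2026.thm415_padicValRat_bsd_rank_le_one)
    (hLLT : LiLiuTian2024.thm11_bsdp_of_cm_rank_one) : WAll :=
  have hmod : hasEntireLFunction_rat :=
    X2.ClassClosureEntireFree.hasEntireLFunction_rat_of_nonempty_modularParametrizationData hmodP
  have hGZK : rank_eq_analyticRank_of_analyticRank_le_one :=
    rank_eq_analyticRank_of_analyticRank_le_one_of_nonempty_modularParametrizationData hmodP hWa hMM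
      hGZ hKo
  wAll_of_exclusions_primaryGZ
    (wAllExclusions_of_finestLeaves_x1ShaWitness h5 hM3 hG3 hT3 hW0 hWT hWO h50 h5S h5O hK2a hK2b hCT
      hCassels hmin hwit hX1R1 hX2 hK3 h73 h75 hK6 hX10b hX11a hF3 hF5 hF2 hFr hW hmod hGZK)
    hSk hBCS hJSW hCGS hGV hGr hmodP hWa hMM hGZ hKo hCM hKob hYZ hLLT

end Summit.BirchSwinnertonDyer.Rank1Residual.WAll

end
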